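import Literature.Barriers.PneNP.Algebrization
import Mathlib.Analysis.Asymptotics.Defs
import Mathlib.Algebra.Order.BigOperators.Group.Finset
import HarnessLib

/-!
# Barrier catalogue `PneNP`: relativized circuit size (Wilson 1985)

D-0021 barrier entry for the summit `PneNP` (`∃ L ∈ NP, L ∉ P`), bearing on its strengthening
by circuit lower bounds — route PneNP/Circuit (thesis `NP ⊄ P/poly`; crux #2 superlinear size
`∃ L ∈ NP, ∀ c, ∃ᶠ n, c·n < circuitSize L n`, filed as `CircuitSuperlinear`; crux #4
fixed-polynomial `∀ k, ∃ L ∈ NP, L ∉ SIZE(n^k)`) and route PneNP/Circuit2 (crux #3,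
`SAT ∉ ⋃_c SIZE(c·n² + c)`): Baker–Gill–Solovay-style contrary oracles for the *circuit size of
uniform classes*, in an intrinsically circuit-based oracle model (circuits with oracle gates, an
oracle gate charged by its number of input wires). The route file PneNP/Circuit records that
"pure diagonalization/simulation (the Kannan-style ancestry of #4) relativizes and cannot reach
NP"; this entry vendors the printed oracle results behind that remark.

**The printed results** (C. B. Wilson, *Relativized circuit complexity*, J. Comput. Syst. Sci.
31 (1985) 169–181 [Wilson1985]; held, `lit read paper:doi-10-1016-0022-0000-85-90040-6`, PDF
page = journal page − 168):

* §2 (pp. 171–172): "A relativized circuit will have `n` inputs (in terms of which its size will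
  be measured), generally one output, and is built up from binary logical gates (and, or, not,
  1, 0) and oracle gates. An oracle gate is a `k`-input 1-output gate which on input `x` of
  length `k` outputs 1 if `x` is in the given oracle and 0 otherwise." "`SIZE^A(t(n))` will be
  the set of those languages `L` for which there is a family of circuits `{α_n}` relative to the
  oracle `A` such that `L ∩ {0,1}ⁿ` is the set of strings accepted by `α_n` and each `α_n` has no
  more than `t(n)` edges." `POLY-SIZE^A := ⋃_k SIZE^A(n^k)`.
* §1.2 (p. 170): "(a) There exists an oracle `B` such that `Δ₂^{P,B}` has bounded linear size
  circuits relative to `B`. This tells us that we will not be able to obtain non-linear lower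
  bounds for the circuit size of sets in P (or NP or `Δ₂^P` for that matter) with a proof
  technique which relativizes. ... (b) There exists an oracle `C` such that for no fixed integer
  `k` does `P^C` have `n^k` size circuits relative to `C` (and yet `NP^C ≠ coNP^C`). Due to the
  difficulty of obtaining non-linear lower bounds for sets in P, one might be tempted to prove
  the opposite. The oracle `C` indicates that this too would require a non-relativizable proof
  technique."
* Lemma 2 (p. 173; for a time bound `T`, an oracle `B` with
  `Δ₂^{T(cn^k),B} ⊆ SIZE^B(log T(cn^k + o(n^k)) + cn^k + n + o(n^k))` for all `c, k ≥ 1`; the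
  circuit is a single oracle gate querying `⟨i,x⟩α`, the index `i` of the `Δ₂` machine and the
  stage string `α` hard-wired, p. 173 Fig. 1), and from it (p. 175, with `T(n) = n^{log n}`,
  `c = k = 1`): **Theorem 3.1.** "`∃ B, Δ₂^{P,B} ⊆ SIZE^B(2n + o(n))`." **Theorem 3.2.**
  "`∃ B, Δ₂^{EXT,B} ⊆ ⋃_c SIZE^B(cn)`" (`EXT = 2^{O(n)}`). **Theorem 3.3.**
  "`∃ B, Δ₂^{EXP,B} ⊆ POLY-SIZE^B`." P. 175: "First we see that [Kannan's
  `∀ k, Σ₂^P ∩ Π₂^P ⊄ SIZE(n^k)`] cannot be improved by a relativizable proof technique to show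
  that `Δ₂^P` is not in `SIZE(n^k)` for any `k`. ... the result of Karp and Lipton cannot be
  improved by a relativizable proof [to a collapse to `Δ₂^P`, even from the hypothesis that
  `Δ₂^P` has bounded linear size circuits]. Further, the theorem dashes any hopes of easily
  exhibiting non-linear circuit-size lower bounds for sets low in the polynomial hierarchy. The
  theorem seems somewhat surprising in view of Blum's lower bound of a set in P requiring
  circuit size `3n`. This points out an example of a proof technique which does not
  relativize."
* **Theorem 4** (p. 176). "There exists an oracle `C` such that `NP^C ≠ coNP^C` and
  `∀ k, P^C ⊄ SIZE^C(n^k)`." (Proof pp. 176–177: `L_k(C) = {x : x0^{|x|^{2k+2}} ∈ C} ∈ P^C`;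
  at one length `n = n_k` per `k`, with `2ⁿ > n^{2k+1}`, "all `n`-input 1-output circuits of size
  `< n^k` are cancelled" by a majority-vote diagonalization, using the count "the number of
  subsets of `{0,1}ⁿ` accepted by circuits of size at most `n^k` relative to a fixed oracle is
  bounded by `2^{n^{2k+1}}`"; `n_k` increases with `k`.) P. 178: the situation of Thm. 4 holds
  relative to a random oracle (Bennett–Gill; Gasarch). **Theorem 5** (p. 178): "`∃ D`,
  `P^D ⊆ SIZE^D(2n + o(n))` and `∀ k, R^D ⊄ SIZE^D(n^k)`."
* §4 (p. 180): "By exhibiting relativizations of different relationships between members of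
  the PH, we have shown that current (i.e., relativizable) proof methods will be insufficient to
  handle certain questions of uniform versus non-uniform complexity measures."
* [Aaronson2006] §1 (arXiv p. 3): "Just as Baker, Gill, and Solovay gave a relativized world
  where `P = NP`, so Wilson gave relativized worlds where `NP` and `P^NP` have linear-size
  circuits. Since the results of Kannan and Bshouty et al. relativize, this suggests that new
  techniques will be needed to make further progress"; ibid. Thm. 2 (arXiv p. 7): an oracle
  relative to which `PP` has linear-size circuits, whereas Vinodchandran's `PP ⊄ SIZE(n^k)` is
  proved "by a nonrelativizing argument" (abstract, §1.1).

**What this file adds.** Over the tree's oracle circuits `SIZERel A s` (circuits over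
`B₂ ∪ oracleGates A`, an `A_m`-gate charged its fan-in `m`, `Literature.Barriers.PneNP.Algebrization`)
and relativized classes `PRel`, `NPRel`, `coNPRel`, `PRelClass` (`Oracle.lean`):
`DeltaTwoRel B := PRelClass (NP^B) = ⋃_{K ∈ NP^B} P^K` (`= P^{NP^B} = Δ₂^{P,B}`); the two oracle
facts `Wilson1985_thm_3_1` (`∃ B, Δ₂^{P,B} ⊆ SIZE^B(2n + o(n))`, per-language `o(n)`) and
`Wilson1985_thm_4` (`∃ C, NP^C ≠ coNP^C ∧ ∀ k, P^C ⊄ SIZE^C(n^k + k)`), named facts (oracle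
constructions by stages are not formalised in the tree; compare `baker_gill_solovay_eq/_ne`);
the barrier `RelativizedCircuitSize` = both; and the no-go readings, all PROVED from the facts in
the catalogue's vocabulary `Relativizes` (`Relativization.lean`): no oracle-indexed statement
whose `A`-instances yield a language of `Δ₂^{P,A}` (or of `NP^A`, `P^A`, given the tree facts
`self_subset_PRelClass`, `PRel_subset_NPRel`) without linear-size `A`-oracle circuits
relativizes (`Wilson1985_thm_3_1.not_relativizes_superlinear_deltaTwo/_np/_p`); none whose
`A`-instances put `P^A` inside some `SIZE^A(n^k + k)` relativizes
(`Wilson1985_thm_4.not_relativizes_fixedPoly_upper`); `NP = coNP` does not relativize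
(`Wilson1985_thm_4.not_relativizes_NP_eq_coNP`); the linear-size corollaries
`deltaTwo_subset_linear` / `np_subset_linear` (`Δ₂^{P,B}, NP^B ⊆ ⋃_c SIZE^B(c·n + c)`, via
`IsSublinear.two_mul_add_le_linear`).

Rendering notes. (1) `SIZERel` requires the size bound at every length and the tree's circuits
need at least one gate at length `0`, so `SIZE^C(n^k)` read literally over `SIZERel` would be
empty and Thm. 4 vacuous; the clause is rendered `P^C ⊄ SIZE^C(n^k + k)` for every `k`. This is
implied by the printed proof: if `P^C ⊆ SIZE^C_tree(n^k + k)`, then `L_{k'}(C)` for large `k'`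
has such circuits; replacing each `B₂`-gate by an and/or/not/constant gadget multiplies the
number of edges by an absolute constant, giving Wilson-model circuits with `< n^{k'}` edges at the
length `n_{k'} → ∞` where all of them were cancelled (pp. 176–177). (2) In Thm. 3.1 Wilson's
circuit is one oracle gate of fan-in `|⟨i,x⟩α| = 2n + o(n)` fed by the `n` inputs and by
hard-wired constants; in the tree's cost (`oracleGateCost`: fan-in for an oracle gate, `1` per
`B₂`-gate, the two constant gates shared) this is again `2n + o(n)`, the `o(n)` depending on the
language (index encoding `|⟨i,x⟩| = |x| + o(|x|)`, p. 175; time bounds holding for sufficiently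
large `n`, p. 171) — hence the per-language `∃ r, r = o(n)` in `Wilson1985_thm_3_1`. (3) The
tree's basis `B₂` (all gates of fan-in `≤ 2`) contains Wilson's `{∧, ∨, ¬, 1, 0}`; for the upper
bound of Thm. 3.1 this only weakens the rendered statement, for the lower bound of Thm. 4 see
(1). (4) `Δ₂^{P,B}`: "for an oracle `X`, `Δ₂^{P,X}` is defined as the union over `Y ∈ NP^X` of
`P^Y`. So `NP^X ⊆ Δ₂^{P,X} ⊆ Σ₂^{P,X} ∩ Π₂^{P,X}`" (p. 171) — literally the tree's
`PRelClass (NPRel (Oracle.ofLanguage X))`, in the transcript model of `P^Y` (adequate for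
language oracles, `Oracle.lean` module docstring); Lemma 2 realises it by machines querying the
`NP^B`-complete set `K(B) = {(j, y, 0^m) : NM_j^B accepts y within m steps}` (p. 173).

## Sources

* [Wilson1985] pp. 169–181 (PDF pp. 1–13): abstract, §1.2 (a)–(c), §2 (model), Prop. 1, Lemma 2,
  Thms. 3.1–3.3 and discussion (p. 175), Thm. 4 with proof and FACT (pp. 176–177), Thm. 5
  (pp. 178–180), §4 — held, read with `lit read`.
* [Aaronson2006] arXiv cs/0504048 pp. 2–4, 7 (abstract, §1, §1.1, Thm. 2) — held.
* [AaronsonWigderson2008] Thm. 5.6 and §1.2 p. 3 (`NTIME^Ã(2ⁿ) ⊂ SIZE^A(n)`: the algebrizing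
  strengthening, tree fact `Algebrization_npLinearSize`) — held.
* [GolovnevHirschKnopKulikov2016] (limits of gate elimination; tree entry
  `Literature.Barriers.PneNP.GateEliminationLimit`).
-/

namespace Literature.Barriers.PneNP

open _root_.Computability Literature.Computability.Complexity Filter Asymptotics Finset

/-! ### `Δ₂^{P,B}` and sublinear functions -/

/-- **`Δ₂^{P,B}`**: "for an oracle `X`, `Δ₂^{P,X}` is defined as the union over `Y ∈ NP^X` of
`P^Y`" — the tree's `PRelClass (NP^B) = ⋃_{K ∈ NP^B} P^K` (polynomial time relative to some
language of `NP^B`; equivalently relative to the `NP^B`-complete set `K(B)` of Lemma 2).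
[cite: Wilson1985, §2 p. 171 and Lemma 2 (p. 173)] -/
noncomputable def DeltaTwoRel (B : Language Bool) : Set (Language Bool) :=
  PRelClass (NPRel (Oracle.ofLanguage B))

/-- Unfolding: `L ∈ Δ₂^{P,B} ↔ ∃ K ∈ NP^B, L ≤ᵀₚ K` (`L ∈ P^K`). [cite: Wilson1985, §2 p. 171] -/
theorem mem_deltaTwoRel_iff {B L : Language Bool} :
    L ∈ DeltaTwoRel B ↔ ∃ K ∈ NPRel (Oracle.ofLanguage B), PolyTimeTuringReducible L K :=
  mem_PRelClass_iff

/-- `NP^B ⊆ Δ₂^{P,B}` (from the tree fact `self_subset_PRelClass : C ⊆ P^C`).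
[cite: Wilson1985, §2 p. 171 ("`NP^X ⊆ Δ₂^{P,X}`")] -/
theorem NPRel_subset_deltaTwoRel (hself : self_subset_PRelClass) (B : Language Bool) :
    NPRel (Oracle.ofLanguage B) ⊆ DeltaTwoRel B :=
  hself _

/-- `P^B ⊆ Δ₂^{P,B}` (from the tree facts `PRel_subset_NPRel`, `self_subset_PRelClass`).
[cite: Wilson1985, §2 p. 171] -/
theorem PRel_subset_deltaTwoRel (hself : self_subset_PRelClass) (hPNP : PRel_subset_NPRel)
    (B : Language Bool) : PRel (Oracle.ofLanguage B) ⊆ DeltaTwoRel B :=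
  (hPNP _).trans (hself _)

/-- `r = o(n)`: a sublinear size term (`‖r n‖ =o ‖n‖` at `atTop`). [folklore] -/
def IsSublinear (r : ℕ → ℕ) : Prop :=
  (fun n => (r n : ℝ)) =o[atTop] (fun n => (n : ℝ))

/-- The zero function is `o(n)`. [folklore] -/
theorem isSublinear_zero : IsSublinear (fun _ => 0) := by
  unfold IsSublinear
  simp only [Nat.cast_zero]
  exact isLittleO_zero _ _

/-- A size bound `2n + o(n)` is bounded by `c·n + c` for a constant `c` (depending on the `o(n)`
term): `o(n) ≤ n` from some `N` on, and the finitely many earlier values are absorbed in `c`.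
[folklore] -/
theorem IsSublinear.two_mul_add_le_linear {r : ℕ → ℕ} (h : IsSublinear r) :
    ∃ c : ℕ, ∀ n, 2 * n + r n ≤ c * n + c := by
  have h1 : ∀ᶠ n : ℕ in atTop, ‖(r n : ℝ)‖ ≤ 1 * ‖(n : ℝ)‖ := isLittleO_iff.1 h zero_lt_one
  rw [eventually_atTop] at h1
  obtain ⟨N, hN⟩ := h1
  set M := ∑ i ∈ range N, r i with hM
  refine ⟨max 3 M, fun n => ?_⟩
  have h3 : 3 ≤ max 3 M := le_max_left _ _
  have hMle : M ≤ max 3 M := le_max_right _ _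
  rcases le_or_gt N n with hn | hn
  · have hrn : r n ≤ n := by
      have := hN n hn
      simp only [Real.norm_natCast, one_mul, Nat.cast_le] at this
      exact this
    calc 2 * n + r n ≤ 3 * n := by omega
      _ ≤ max 3 M * n := Nat.mul_le_mul_right n h3
      _ ≤ max 3 M * n + max 3 M := Nat.le_add_right _ _
  · have hrM : r n ≤ M := by
      rw [hM]
      exact single_le_sum (f := r) (fun i _ => Nat.zero_le _) (mem_range.2 hn)
    calc 2 * n + r n ≤ 3 * n + M := by omega
      _ ≤ max 3 M * n + max 3 M := Nat.add_le_add (Nat.mul_le_mul_right n h3) hMle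

/-! ### The two oracle facts -/

/-- **Wilson 1985, Theorem 3.1: "`∃ B, Δ₂^{P,B} ⊆ SIZE^B(2n + o(n))`."** There is an oracle
language `B` such that every language of `Δ₂^{P,B} = P^{NP^B}` is decided by a family of
`B`-oracle circuits of size `2n + o(n)`. Rendered over the tree's `SIZERel` (basis
`B₂ ∪ oracleGates B`, fan-in-charged size, bound at every length) with a sublinear term `r = o(n)`
depending on the language (Wilson's circuit: one oracle gate of fan-in `2n + o(n)` plus hard-wired
constants; module docstring, rendering note (2)). Named fact: the stage construction of `B`
(Lemma 2, pp. 173–175) is not formalised. [cite: Wilson1985, Thm. 3.1 (p. 175) with Lemma 2 (p. 173)] -/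
def Wilson1985_thm_3_1 : Prop :=
  ∃ B : Language Bool, ∀ L ∈ DeltaTwoRel B,
    ∃ r : ℕ → ℕ, IsSublinear r ∧ L ∈ SIZERel B (fun n => 2 * n + r n)

/-- **Wilson 1985, Theorem 4: "There exists an oracle `C` such that `NP^C ≠ coNP^C` and
`∀ k, P^C ⊄ SIZE^C(n^k)`."** Rendered over the tree's `SIZERel` with the bound `n^k + k` (the
literal `n^k` would make `SIZERel C (· ^ k)` empty at length `0` and the clause vacuous; the
`+ k` form is implied by the printed proof, whose diagonalization cancels, for each `k'`, all
circuits with `< n^{k'}` edges at a length `n_{k'} → ∞` — module docstring, rendering note (1)).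
Named fact: the stage construction of `C` (pp. 176–177) is not formalised.
[cite: Wilson1985, Thm. 4 (pp. 176–177)] -/
def Wilson1985_thm_4 : Prop :=
  ∃ C : Language Bool, NPRel (Oracle.ofLanguage C) ≠ coNPRel (Oracle.ofLanguage C) ∧
    ∀ k : ℕ, ¬ PRel (Oracle.ofLanguage C) ⊆ SIZERel C (fun n => n ^ k + k)

/-- Non-vacuity of the rendering of Thm. 4: the classes `SIZE^C(n^k + k)`, `k ≥ 1`, are not
empty — the oracle language itself has one-gate oracle circuits of cost `≤ n + 1`
(`self_mem_SIZERel`, `Algebrization.lean`). [cite: Wilson1985, §2 p. 172 (the model)] -/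
theorem self_mem_SIZERel_pow {C : Language Bool} {k : ℕ} (hk : 1 ≤ k) :
    C ∈ SIZERel C (fun n => n ^ k + k) := by
  refine SIZERel_mono C (fun n => ?_) (self_mem_SIZERel C)
  rcases Nat.eq_zero_or_pos n with rfl | hn
  · have h0 : 0 ^ k = 0 := Nat.zero_pow (by omega)
    rw [h0]
    omega
  · exact Nat.add_le_add (by simpa using Nat.pow_le_pow_right hn hk) hk

/-! ### The barrier fact -/

/-- **Relativized circuit size (Wilson 1985): contrary oracles for the circuit size of `P`, `NP`,
`Δ₂^P`.** The conjunction of Thm. 3.1 (`∃ B, Δ₂^{P,B} ⊆ SIZE^B(2n + o(n))`: relative to `B` even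
`P^{NP}` has linear-size circuits) and Thm. 4 (`∃ C, NP^C ≠ coNP^C ∧ ∀ k, P^C ⊄ SIZE^C(n^k)`:
relative to `C` already `P` has no fixed-polynomial-size circuits).

BARRIER
technique_class: relativizing, relativization, diagonalization, simulation, oracle-circuits, relativized-circuit-complexity, circuit-lower-bounds, superlinear-circuit-lower-bounds, linear-circuit-lower-bounds, fixed-polynomial-circuit-bounds, b2-circuits
blocks: relativizing proofs (proofs holding relative to every oracle in Wilson's oracle-circuit model, `Relativizes`) of any superlinear circuit-size lower bound for a language in `P`, `NP` or `Δ₂^P` — the strengthenings of `PneNP` filed on route PneNP/Circuit as crux #2 (superlinear size, `CircuitSuperlinear`), crux #4 (fixed-polynomial `NP ⊄ SIZE(n^k)`) and thesis `NP ⊄ P/poly`, and on route PneNP/Circuit2 as crux #3 (`SAT ∉ SIZE(O(n²))`): "we will not be able to obtain non-linear lower bounds for the circuit size of sets in P (or NP or `Δ₂^P` for that matter) with a proof technique which relativizes" (proved readings `Wilson1985_thm_3_1.not_relativizes_superlinear_deltaTwo/_np/_p`, `deltaTwo_subset_linear`); relativizing improvements of Kannan's `Σ₂^P ∩ Π₂^P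 ⊄ SIZE(n^k)` to `Δ₂^P` and of the Karp–Lipton collapse to `Δ₂^P`; and, in the other direction, relativizing proofs that `P` (hence `NP`) HAS circuits of some fixed polynomial size (`Wilson1985_thm_4.not_relativizes_fixedPoly_upper`) [cite: Wilson1985, §1.2 (a)–(b) p. 170, Thms. 3.1 and 4, discussion p. 175] [cite: Aaronson2006, §1 (arXiv p. 3)].
because: relative to the oracle `B` of Lemma 2 / Thm. 3.1, built in stages so that for every `Δ₂` machine `M_i` and input `x` the single query `⟨i,x⟩α_N` to `B` answers whether `M_i^{K(B)}` accepts `x` (the stage string `α_N`, of length `log T(N) + N + 3`, chosen outside the `< 2^{N+3}T(N)` reserved strings), every `Δ₂^{P,B}` language has circuits consisting of one oracle gate with `2n + o(n)` input wires [cite: Wilson1985, Lemma 2 and its proof (pp. 173–175)]; relative to `C`, a Baker–Gill–Solovay step keeps `0ⁿ ∈ L(C) ⇔ NM_i^C` rejects, and for each `k` at one length `n` with `2ⁿ > n^{2k+1}` a majority-vote diagonalization over the `≤ 2^{n^{2k+1}}` functions computed by `n^k`-edge oracle circuits puts `L_k(C) = {x : x0^{|x|^{2k+2}} ∈ C} ∈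 P^C` outside `SIZE^C(n^k)`, the padding `0^{|x|^{2k+2}}` keeping the diagonalizing strings longer than any query of an `n^k`-edge circuit [cite: Wilson1985, proof of Thm. 4 (pp. 176–177)]; so neither a superlinear lower bound nor a fixed-polynomial upper bound for these classes survives all oracles (`not_relativizes_of_contrary`, `Relativization.lean`).
evasions_known: gate elimination does not relativize in this model — Blum's `3n` lower bound for a language in `P` exceeds the relativized `2n + o(n)` ("an example of a proof technique which does not relativize") [cite: Wilson1985, p. 175] — but is itself capped at linear bounds (tree entry `GateEliminationLimit`) [cite: GolovnevHirschKnopKulikov2016, Lemma 1 and §1]; fixed-polynomial lower bounds ARE provable higher up by relativizing arguments — Kannan's `Σ₂^P ⊄ SIZE(n^k)`, `ZPP^{NP} ⊄ SIZE(n^k)` (Köbler–Watanabe via Bshouty et al.), `S₂^P` (Cai) — and for `PP` by Vinodchandran's NON-relativizing argument (Aaronson: an oracle making `PP` linear-size, so `PP ⊄ SIZE(n^k)` is "the first nonrelativizing separation of 'traditional' complexity classes") [cite: Aaronson2006, abstract, §1 and Thm. 2 (arXiv pp. 2–4, 7)]; arithmetization-based non-relativizing techniques are in turn stopped for `NP ⊄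 SIZE(O(n))` by algebrization (`NTIME^Ã(2ⁿ) ⊂ SIZE^A(n)`, tree fact `Algebrization_npLinearSize`) [cite: AaronsonWigderson2008, Thm. 5.6 and §1.2 p. 3].
scope_caveats: the model matters: oracle gates of arbitrary fan-in charged by their input wires (Wilson §2; the tree's `oracleGateCost`), and "relativizing" means holding for ALL language oracles in this model — a weak requirement that known explicit linear lower bounds (`3n`, gate elimination) already violate by constant factors, so the entry obstructs only oracle-independent arguments, not "combinatorial" ones [cite: Wilson1985, p. 175 and §4 p. 180]; Thm. 3.1 is rendered with a per-language `o(n)` term and Thm. 4 with `n^k + k` in place of `n^k` over the larger basis `B₂` (module docstring, rendering notes (1)–(3): implied by the printed proofs, not verbatim); Thms. 3.2, 3.3 (`Δ₂^{EXT}`, `Δ₂^{EXP}`), Thm. 5 (`P^D` linear-size but `R^D ⊄ SIZE^D(n^k)`), Prop. 1 and the random-oracle remarks (p. 178) are quoted only; the relativized classes are the tree's transcript model `PRel`/`NPRel`/`PRelClass`, adequate for language oracles (`Oracle.lean`); (audit 2026-08-16; the decls named in (a)–(d) live in `Literature.Barriers.PneNP.RelativizedCircuitSizeSparse`, the narrowed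 entry is `RelativizedCircuitSizeNarrow` there, proved) (a) the `technique_class` keywords `diagonalization, simulation, b2-circuits, circuit-lower-bounds, …` are covered ONLY insofar as the whole argument relativizes with oracle gates of UNBOUNDED fan-in over ALL (dense) oracles — the barrier is carried by ONE oracle gate of fan-in `2n + o(n)` of a DENSE oracle [cite: Wilson1985, Lemma 2 (pp. 173–175), Fig. 1]: over TALLY oracles the oracle gates are `B₂`-gates, `SIZE^T(s) ⊆ SIZE(s+1)` (`IsTally.SIZERel_subset_SIZE`), and the superlinear / fixed-polynomial / `P/poly` lower-bound shapes for `NP`, `P`, `Δ₂ᵖ` hold relative to all tally oracles iff they hold (`np_tally_superlinear_iff`, `np_tally_fixedPoly_iff`, `np_tally_superpoly_iff`, `p_tally_superlinear_iff`, `deltaTwo_tally_superlinear_iff`); (b) over SPARSE oracles a contrary world (`NP^S` or `Δ₂^{P,S}` inside `⋃_c SIZE^S(c·n + c)`) would prove `NP ⊆ P/poly` (`NP_subset_PPoly_of_sparse_np_linear`, `NP_subset_PPoly_of_sparse_deltaTwo_linear`), so unless `NP ⊆ P/poly` every lower-bound shape for `NP` is sparse-relativizing (`np_sparse_superpoly`,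 `cRelativizes_sparse_of_NP_not_subset_PPoly`) and Wilson's `B` is dense (`wilson_oracle_dense`) [cite: Schoning1995, §4 (pp. 528–529)]; (c) oracle gates of fan-in `K(n)` with `2^{K(n)} ≤ poly(n)` carry no barrier for ANY oracle (`NP_subset_PPoly_of_fanIn_np_linear`; Wilson's Thm. 0 and the FACT of Thm. 4 are the printed results with a query-length parameter) [cite: Wilson1985, Thm. 0 (p. 172) and p. 176]; (d) the barrier concerns NON-UNIFORM circuits only — `∀ k, P ⊄ P-uniform SIZE(n^k)` and `NP ⊄ P^{NP}_{||}-uniform SIZE(n^k)` are theorems by diagonalization [cite: SanthanamWilliams2014, Thms. 1.1 and 1.3], Wilson's circuits hard-wiring the non-uniform stage strings `α_N`; (e) (audit 2026-08-16, part 2: `Literature.Barriers.PneNP.RelativizedCircuitSizeThm4Scope`) the Thm. 4 clause `∀ k, ¬ P^C ⊆ SIZERel C (n^k + k)` holds at EVERY oracle — `SIZERel` bounds the size at every length and a FINITE language (in `P ⊆ P^A`) beats all `A`-circuits of size `n^k + k` at one length by the counting FACT (`not_PRel_subset_SIZERel_pow`, `exists_NPRel_not_mem_SIZERel_pow`) —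 so `Wilson1985_thm_4 ↔ ∃ C, NP^C ≠ coNP^C` (`wilson1985_thm_4_iff_exists_NP_ne_coNP`), the reading `not_relativizes_fixedPoly_upper` is vacuous (its hypothesis forces `Φ` false at every language oracle, `fixedPoly_upper_hypothesis_forces_false`; `¬ Φ` relativizes) and the `blocks:` item "relativizing proofs that `P` HAS circuits of some fixed polynomial size" is NOT backed by the formal content: the intended statement is `∃ k, P ⊆ ⋃_c SIZE(c·n^k + c)`, true at Wilson's `B` (`exists_oracle_P_subset_linear`) but lacking its contrary oracle `∀ k, P^C ⊄ ⋃_c SIZE^C(c·n^k + c)` in the tree (Wilson's printed diagonalization cancels one length per `k`, p. 177; the `O(n^k)` form needs dovetailing or a `P^C = NP^C` world plus relativized Kannan, p. 176) [cite: Wilson1985, proof of Thm. 4 (p. 177) and p. 176].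
status: established [cite: Wilson1985, Thms. 3.1 and 4] -/
def RelativizedCircuitSize : Prop :=
  Wilson1985_thm_3_1 ∧ Wilson1985_thm_4

/-- Unfolding of the barrier into the two oracle facts. [cite: Wilson1985, Thms. 3.1 and 4] -/
theorem relativizedCircuitSize_iff :
    RelativizedCircuitSize ↔ Wilson1985_thm_3_1 ∧ Wilson1985_thm_4 :=
  Iff.rfl

/-! ### Readings of Theorem 3.1 (proved from the fact) -/

/-- **`Δ₂^{P,B}` has linear-size circuits relative to `B`**: `Δ₂^{P,B} ⊆ ⋃_c SIZE^B(c·n + c)`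
("bounded linear size", §1.2 (a)). [cite: Wilson1985, Thm. 3.1 (p. 175) and §1.2 (a) (p. 170)] -/
theorem Wilson1985_thm_3_1.deltaTwo_subset_linear (h : Wilson1985_thm_3_1) :
    ∃ B : Language Bool, DeltaTwoRel B ⊆ ⋃ c : ℕ, SIZERel B (fun n => c * n + c) := by
  obtain ⟨B, hB⟩ := h
  refine ⟨B, fun L hL => ?_⟩
  obtain ⟨r, hr, hLr⟩ := hB L hL
  obtain ⟨c, hc⟩ := hr.two_mul_add_le_linear
  exact Set.mem_iUnion.2 ⟨c, SIZERel_mono B hc hLr⟩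

/-- **`NP^B` has linear-size circuits relative to `B`** (given the tree fact `NP^B ⊆ P^{NP^B}`,
`self_subset_PRelClass`). [cite: Wilson1985, Thm. 3.1 and §1.2 (a)] [cite: Aaronson2006, §1 (arXiv p. 3)] -/
theorem Wilson1985_thm_3_1.np_subset_linear (h : Wilson1985_thm_3_1)
    (hself : self_subset_PRelClass) :
    ∃ B : Language Bool, NPRel (Oracle.ofLanguage B) ⊆ ⋃ c : ℕ, SIZERel B (fun n => c * n + c) := by
  obtain ⟨B, hB⟩ := h.deltaTwo_subset_linear
  exact ⟨B, (NPRel_subset_deltaTwoRel hself B).trans hB⟩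

/-- The same for every polynomial bound `n ↦ n^k`, `k ≥ 1`: relative to `B`,
`Δ₂^{P,B} ⊆ ⋃_c SIZE^B(c·n^k + c)` (so also the shapes `NP ⊄ SIZE(n^k)`, `NP ⊄ P/poly` have a
contrary oracle). [cite: Wilson1985, Thm. 3.1 and p. 175] -/
theorem Wilson1985_thm_3_1.deltaTwo_subset_pow (h : Wilson1985_thm_3_1) {k : ℕ} (hk : 1 ≤ k) :
    ∃ B : Language Bool, DeltaTwoRel B ⊆ ⋃ c : ℕ, SIZERel B (fun n => c * n ^ k + c) := by
  obtain ⟨B, hB⟩ := h.deltaTwo_subset_linear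
  refine ⟨B, hB.trans (Set.iUnion_mono fun c => SIZERel_mono B fun n => ?_)⟩
  rcases Nat.eq_zero_or_pos n with rfl | hn
  · simp
  · exact Nat.add_le_add_right (Nat.mul_le_mul_left c (by simpa using Nat.pow_le_pow_right hn hk)) c

/-- **Superlinear circuit lower bounds for `Δ₂^P` do not relativize.** No oracle-indexed
statement `Φ` whose instance at every language oracle `A` yields a language of `Δ₂^{P,A}` without
`A`-oracle circuits of size `c·n + c` for any `c` holds relative to all oracles: it fails at
Wilson's `B`. [cite: Wilson1985, §1.2 (a) (p. 170) and Thm. 3.1] -/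
theorem Wilson1985_thm_3_1.not_relativizes_superlinear_deltaTwo (h : Wilson1985_thm_3_1)
    {Φ : Oracle → Prop}
    (hΦ : ∀ A : Language Bool, Φ (Oracle.ofLanguage A) →
      ∃ L ∈ DeltaTwoRel A, ∀ c : ℕ, L ∉ SIZERel A (fun n => c * n + c)) :
    ¬ Relativizes Φ := by
  intro hrel
  obtain ⟨B, hB⟩ := h.deltaTwo_subset_linear
  obtain ⟨L, hL, hnot⟩ := hΦ B (hrel B)
  obtain ⟨c, hc⟩ := Set.mem_iUnion.1 (hB hL)
  exact hnot c hc

/-- **Superlinear circuit lower bounds for `NP` do not relativize** ("or NP"; given the tree fact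
`self_subset_PRelClass`): the shape of route PneNP/Circuit's crux `CircuitSuperlinear`
(`NP ⊄ SIZE(O(n))`), relativized. [cite: Wilson1985, §1.2 (a) (p. 170) and Thm. 3.1] [cite: Aaronson2006, §1 (arXiv p. 3)] -/
theorem Wilson1985_thm_3_1.not_relativizes_superlinear_np (h : Wilson1985_thm_3_1)
    (hself : self_subset_PRelClass) {Φ : Oracle → Prop}
    (hΦ : ∀ A : Language Bool, Φ (Oracle.ofLanguage A) →
      ∃ L ∈ NPRel (Oracle.ofLanguage A), ∀ c : ℕ, L ∉ SIZERel A (fun n => c * n + c)) :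
    ¬ Relativizes Φ :=
  h.not_relativizes_superlinear_deltaTwo fun A hA =>
    let ⟨L, hL, hnot⟩ := hΦ A hA
    ⟨L, NPRel_subset_deltaTwoRel hself A hL, hnot⟩

/-- **Superlinear circuit lower bounds for `P` do not relativize** ("sets in P"; given the tree
facts `PRel_subset_NPRel`, `self_subset_PRelClass`). [cite: Wilson1985, §1.2 (a) (p. 170) and Thm. 3.1] -/
theorem Wilson1985_thm_3_1.not_relativizes_superlinear_p (h : Wilson1985_thm_3_1)
    (hself : self_subset_PRelClass) (hPNP : PRel_subset_NPRel) {Φ : Oracle → Prop}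
    (hΦ : ∀ A : Language Bool, Φ (Oracle.ofLanguage A) →
      ∃ L ∈ PRel (Oracle.ofLanguage A), ∀ c : ℕ, L ∉ SIZERel A (fun n => c * n + c)) :
    ¬ Relativizes Φ :=
  h.not_relativizes_superlinear_deltaTwo fun A hA =>
    let ⟨L, hL, hnot⟩ := hΦ A hA
    ⟨L, PRel_subset_deltaTwoRel hself hPNP A hL, hnot⟩

/-! ### Readings of Theorem 4 (proved from the fact) -/

/-- **Fixed-polynomial circuit UPPER bounds for `P` do not relativize** ("one might be tempted
to prove the opposite. The oracle `C` indicates that this too would require a non-relativizable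
proof technique"): no `Φ` whose `A`-instances give `P^A ⊆ SIZE^A(n^k + k)` for some `k` holds
relative to all oracles. [cite: Wilson1985, §1.2 (b) (p. 170) and Thm. 4] -/
theorem Wilson1985_thm_4.not_relativizes_fixedPoly_upper (h : Wilson1985_thm_4)
    {Φ : Oracle → Prop}
    (hΦ : ∀ A : Language Bool, Φ (Oracle.ofLanguage A) →
      ∃ k : ℕ, PRel (Oracle.ofLanguage A) ⊆ SIZERel A (fun n => n ^ k + k)) :
    ¬ Relativizes Φ := by
  intro hrel
  obtain ⟨C, -, hC⟩ := h
  obtain ⟨k, hk⟩ := hΦ C (hrel C)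
  exact hC k hk

/-- Relative to Wilson's `C`, for every `k` some language of `P^C` — hence of `NP^C` (tree fact
`PRel_subset_NPRel`) — lies outside `SIZE^C(n^k + k)`: the contrary world to Thm. 3.1's `B`
for fixed-polynomial lower bounds. [cite: Wilson1985, Thm. 4 and p. 178] -/
theorem Wilson1985_thm_4.exists_np_not_mem_SIZERel (h : Wilson1985_thm_4)
    (hPNP : PRel_subset_NPRel) :
    ∃ C : Language Bool, ∀ k : ℕ,
      ∃ L ∈ NPRel (Oracle.ofLanguage C), L ∉ SIZERel C (fun n => n ^ k + k) := by
  obtain ⟨C, -, hC⟩ := h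
  refine ⟨C, fun k => ?_⟩
  obtain ⟨L, hL, hnot⟩ := Set.not_subset.1 (hC k)
  exact ⟨L, hPNP _ hL, hnot⟩

/-- `NP = coNP` does not relativize (Wilson's `C` has `NP^C ≠ coNP^C`). [cite: Wilson1985, Thm. 4] -/
theorem Wilson1985_thm_4.not_relativizes_NP_eq_coNP (h : Wilson1985_thm_4) :
    ¬ Relativizes fun O => NPRel O = coNPRel O := by
  intro hrel
  obtain ⟨C, hne, -⟩ := h
  exact hne (hrel C)

/-! ### Summary from the barrier -/

/-- Both directions at once: from `RelativizedCircuitSize`, (i) no relativizing superlinear lower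
bound for `Δ₂^P`-languages and (ii) no relativizing fixed-polynomial upper bound for `P`.
[cite: Wilson1985, §1.2 (a)–(b), Thms. 3.1 and 4] -/
theorem RelativizedCircuitSize.summary (h : RelativizedCircuitSize) :
    (∀ Φ : Oracle → Prop,
      (∀ A : Language Bool, Φ (Oracle.ofLanguage A) →
        ∃ L ∈ DeltaTwoRel A, ∀ c : ℕ, L ∉ SIZERel A (fun n => c * n + c)) →
      ¬ Relativizes Φ) ∧
    ∀ Φ : Oracle → Prop,
      (∀ A : Language Bool, Φ (Oracle.ofLanguage A) →
        ∃ k : ℕ, PRel (Oracle.ofLanguage A) ⊆ SIZERel A (fun n => n ^ k + k)) →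
      ¬ Relativizes Φ :=
  ⟨fun _ hΦ => h.1.not_relativizes_superlinear_deltaTwo hΦ,
    fun _ hΦ => h.2.not_relativizes_fixedPoly_upper hΦ⟩

end Literature.Barriers.PneNP
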